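import Summits.Langlands.Langlands.Theses.EvenSkinnerWilesMirror

/-!
# Birth skeleton of the piece X₃ `RegularDescentOddGaloisRep` (child of crux stmt-Langlands-15309 `BianchiMirrorParity`)

Deligne's theorem for a cuspidal `π₀` on `GL₂(𝔸_ℚ)` with REGULAR `L`-algebraic infinity type, cut along
existence / parity: (A) EXISTENCE of an `r : Γ_ℚ → GL₂(ℚ̄_p)` Satake–Frobenius compatible with `π₀` at cofinitely
many `v` (`π₀ = π_g ⊗ |det|^j`, `g` holomorphic of weight `a₁ − a₂ + 1 ≥ 2`, `r = r_{g,ι} ⊗ ε^j`; Deligne 1971,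
Eichler–Shimura), (B) PARITY: every `r` so compatible is odd (`r^{ss} ≅ r_{g,ι} ⊗ ε^j` by Chebotarev +
Brauer–Nesbitt, and `det r_g(c) = -1`).  `RegularDescentOddGaloisRep_of` composes them.  Both are named-fact
material (the tree has `exists_galoisRep_of_regularAlgebraic`, lang.S27, C-normalised and without parity, and
`NewformGaloisRep.thm61`; the oddness clause is the one printed input the tree lacks — grounder note on the crux).
-/

set_option linter.dupNamespace false

namespace Summit.Langlands.Langlands.Cruxes.BianchiMirrorParity.RegularDescentOddGaloisRepBirth

open Filter
open Literature.NumberTheory.Automorphic Literature.NumberTheory.GaloisRepresentations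

/-- STUB (A) (named-fact material, M): existence of the `p`-adic Galois representation of a cuspidal `π₀` on
`GL₂(𝔸_ℚ)` with regular `L`-algebraic infinity type, in the untwisted `L`-normalised arithmetic-Frobenius
dictionary of `Summit.Langlands.SatakeFrobCompatibleAt` (`π₀ = π_g ⊗ |det|^j` with `g` a holomorphic newform of
weight `≥ 2` — no unitary principal / complementary series of `GL₂(ℝ)` has integral distinct exponents —,
`r = r_{g,ι} ⊗ ε^j`). [cite: Deligne1971, Thm. 6.1] -/
theorem stub_exists_galoisRep_regular_LAlgebraic : ∀ (p : ℕ) [Fact p.Prime] (hℚ : Literature.NumberTheory.Automorphic.isCompact_glFiniteIntegralLevel 2 ℚ) (ι : PadicAlgCl p ≃+* ℂ) (π₀ : Literature.NumberTheory.Automorphic.CuspidalAutomorphicRepData 2 ℚ hℚ), (∃ T : Literature.NumberTheory.Automorphic.InfinityType ℚ 2, π₀.1.HasInfinityType T ∧ T.IsLAlgebraic ∧ T.IsRegular) → ∃ r : Literature.NumberTheory.GaloisRepresentations.FramedGaloisRep ℚ (PadicAlgCl p) 2, ∀ᶠ v in cofinite, Summit.Langlands.SatakeFrobCompatibleAt ι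 π₀.1 r v := by
  sorry

/-- STUB (B) (named-fact material, M): PARITY — every `r` Satake–Frobenius compatible at cofinitely many places
with a cuspidal `π₀` on `GL₂(𝔸_ℚ)` of regular `L`-algebraic infinity type is ODD (`r^{ss} ≅ r_{g,ι} ⊗ ε^j` by
Chebotarev + Brauer–Nesbitt; `det r_g(c) = -1` since `det r_g = χ_g ε^{m-1}` with `χ_g(-1) = (-1)^m`; twists and
duals of an odd representation are odd). [cite: Ribet1977Nebentypus, §2] -/
theorem stub_isOdd_of_compatible_regular_LAlgebraic : ∀ (p : ℕ) [Fact p.Prime] (hℚ : Literature.NumberTheory.Automorphic.isCompact_glFiniteIntegralLevel 2 ℚ) (ι : PadicAlgCl p ≃+* ℂ) (π₀ : Literature.NumberTheory.Automorphic.CuspidalAutomorphicRepData 2 ℚ hℚ), (∃ T : Literature.NumberTheory.Automorphic.InfinityType ℚ 2, π₀.1.HasInfinityType T ∧ T.IsLAlgebraic ∧ T.IsRegular) → ∀ r : Literature.NumberTheory.GaloisRepresentations.FramedGaloisRep ℚ (PadicAlgCl p) 2, (∀ᶠ v in cofinite, Summit.Langlands.SatakeFrobCompatibleAt ι π₀.1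 r v) → r.IsOdd := by
  sorry

/-- **COMPOSITION (no sorry): the two stubs imply X₃ `RegularDescentOddGaloisRep`.** [folklore] -/
theorem RegularDescentOddGaloisRep_of :
    (∀ (p : ℕ) [Fact p.Prime] (hℚ : Literature.NumberTheory.Automorphic.isCompact_glFiniteIntegralLevel 2 ℚ) (ι : PadicAlgCl p ≃+* ℂ) (π₀ : Literature.NumberTheory.Automorphic.CuspidalAutomorphicRepData 2 ℚ hℚ), (∃ T : Literature.NumberTheory.Automorphic.InfinityType ℚ 2, π₀.1.HasInfinityType T ∧ T.IsLAlgebraic ∧ T.IsRegular) → ∃ r : Literature.NumberTheory.GaloisRepresentations.FramedGaloisRep ℚ (PadicAlgCl p) 2, ∀ᶠ v in cofinite, Summit.Langlands.SatakeFrobCompatibleAt ι π₀.1 r v) →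
    (∀ (p : ℕ) [Fact p.Prime] (hℚ : Literature.NumberTheory.Automorphic.isCompact_glFiniteIntegralLevel 2 ℚ) (ι : PadicAlgCl p ≃+* ℂ) (π₀ : Literature.NumberTheory.Automorphic.CuspidalAutomorphicRepData 2 ℚ hℚ), (∃ T : Literature.NumberTheory.Automorphic.InfinityType ℚ 2, π₀.1.HasInfinityType T ∧ T.IsLAlgebraic ∧ T.IsRegular) → ∀ r : Literature.NumberTheory.GaloisRepresentations.FramedGaloisRep ℚ (PadicAlgCl p) 2, (∀ᶠ v in cofinite, Summit.Langlands.SatakeFrobCompatibleAt ι π₀.1 r v) → r.IsOdd) →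
      (∀ (p : ℕ) [Fact p.Prime] (hℚ : Literature.NumberTheory.Automorphic.isCompact_glFiniteIntegralLevel 2 ℚ) (ι : PadicAlgCl p ≃+* ℂ) (π₀ : Literature.NumberTheory.Automorphic.CuspidalAutomorphicRepData 2 ℚ hℚ), (∃ T : Literature.NumberTheory.Automorphic.InfinityType ℚ 2, π₀.1.HasInfinityType T ∧ T.IsLAlgebraic ∧ T.IsRegular) → ∃ r : Literature.NumberTheory.GaloisRepresentations.FramedGaloisRep ℚ (PadicAlgCl p) 2, r.IsOdd ∧ ∀ᶠ v in cofinite, Summit.Langlands.SatakeFrobCompatibleAt ι π₀.1 r v) := by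
  intro hA hB
  intro p _ hℚ ι π₀ hT
  obtain ⟨r, hr⟩ := hA p hℚ ι π₀ hT
  exact ⟨r, hB p hℚ ι π₀ hT r hr, hr⟩

/-- X₃ from the stubs. [folklore] -/
theorem regularDescentOddGaloisRep_of_stubs : (∀ (p : ℕ) [Fact p.Prime] (hℚ : Literature.NumberTheory.Automorphic.isCompact_glFiniteIntegralLevel 2 ℚ) (ι : PadicAlgCl p ≃+* ℂ) (π₀ : Literature.NumberTheory.Automorphic.CuspidalAutomorphicRepData 2 ℚ hℚ), (∃ T : Literature.NumberTheory.Automorphic.InfinityType ℚ 2, π₀.1.HasInfinityType T ∧ T.IsLAlgebraic ∧ T.IsRegular) → ∃ r : Literature.NumberTheory.GaloisRepresentations.FramedGaloisRep ℚ (PadicAlgCl p) 2, r.IsOdd ∧ ∀ᶠ v in cofinite, Summit.Langlands.SatakeFrobCompatibleAt ι π₀.1 r v) :=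
  RegularDescentOddGaloisRep_of stub_exists_galoisRep_regular_LAlgebraic stub_isOdd_of_compatible_regular_LAlgebraic

end Summit.Langlands.Langlands.Cruxes.BianchiMirrorParity.RegularDescentOddGaloisRepBirth
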